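/-
Copyright (c) 2026 the pub-hodgecm-mathlib formalisation cell (harness21).  Prover seat hodgecm-mathlib-K2E1-p12 (g7), Track B ∕ R90-TF, h413 = `stmt-HodgeConjecture-24833`,
R90-TF section S8 «ContSpec-n½», socket (E) :276, E1-PLANCHEREL BODY brick PB-2d «ENTRY LETTERS OF RECORD» (S8 dealer R90-CS-plan (g4) S8-R280 (3)): the per-entry letters
`hs ∕ hr ∕ hB` of ★ PB-2a′ `K2E1PseudoEisensteinContourShiftVectorAxisGeneric` for entry scalars of EXPORT SHAPE `s_{ab}(z) = Σ_j qc_j^{(a)}(z)·G_{abj}` (continued scattering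
coordinates × constant Gram entries), reduced to the programme's smaller letters: the pole ledger in the strip, per-coordinate simple-pole data, per-coordinate box bounds; plus the
finite-dimensional Riesz packaging of entrywise residues into ONE residue operator.  Pure complex analysis + linear algebra, on letters.
-/
import Summits.HodgeConjecture.HodgeConjecture.Theorems.K2E1PseudoEisensteinContourShiftVectorAxisGeneric   -- ★ PB-2a′ (this seat): the consumer of the letters produced here (its `hUo hUs hs hr hB` bytes); brings the analysis imports
import Mathlib.Analysis.InnerProductSpace.PiL2
import HarnessLib

/-!
# PB-2d — `K2E1PseudoEisensteinEntryLettersOfExports`: the entry letters `hs ∕ hr ∕ hB` of the vector contour shift for export-shaped entry scalars `s(z) = Σ_j qc_j(z)·G_j`, from the pole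
# ledger, per-coordinate pole data and per-coordinate box bounds; entrywise residues packaged into one residue operator (pure analysis + linear algebra, on letters)

Track B ∕ R90-TF, crux h413 = `stmt-HodgeConjecture-24833`, route of record `HCCMUnconditional`; cell `hodgecm-mathlib`, R90-TF programme, section S8 «ContSpec-n½», socket (E)
(B ED. 7 :276): the E1-PLANCHEREL BODY at the τ-cut block, bricks PB-1…PB-4 (S8-R254); PB-2 chain ★ (PB-2a p865234, PB-2a′ p865274, PB-2b∕2c p865294+p865306, letters p865331).  THIS
FILE = PB-2d.  THEOREMS ONLY (no `def`, no `instance`, no `notation`, no named-fact hypothesis, no `sorry`; default heartbeats); lane `--supports stmt-HodgeConjecture-24833 --as helper`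
(count-neutral).  No automorphic object.  CLOSES NO SOCKET.

THE MATHEMATICS ([MoeglinWaldspurger1995, IV.1.8–IV.1.11, proof IV.3.12 pp. 161–162]; [BernsteinLapid2019, Thm 2.3]; [Langlands1976, §7]).  At a K-finite block `V` of `U(2,1)_{L∕L⁺}` the ★
exports of record (`K2E1ChiEisensteinMeromorphicExportsKFiniteCMThree.chiEisenstein_meromorphic_exports_kfinite_cm_three_of_gauge_letters`) give, for each section `φ_a ∈ V`, columns
`φ'_j` and CONTINUED SCATTERING COORDINATES `qc_j^{(a)}` — meromorphic on `ℂ`, holomorphic off a closed CO-DISCRETE pole set `P_a ⊆ {Re ≤ 2}` — with `M(z)φ_a ∼ Σ_j qc_j^{(a)}(z)·φ'_j`;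
hence every matrix coefficient of the continued intertwining operator is of EXPORT SHAPE `s_{ab}(z) = ⟪φ′_b, M(z)φ_a⟫ = Σ_j qc_j^{(a)}(z)·G_{abj}` with CONSTANT Gram entries
`G_{abj} = ⟪φ′_b, φ'_j⟫`.  ★ PB-2a′ asks, per entry, `hs` (holomorphy on ONE open `U ⊇ {κ ≤ Re ≤ σ₀}` off a finset `S ⊂ (κ, σ₀)` of real poles), `hr` (residues `(z − c)s_{ab}(z) →
⟪φ′_b, R_c φ_a⟫`) and `hB` (a strip bound at `|Im z| ≥ 1`).  This file reduces them to three smaller letters of the programme: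
(i) the POLE LEDGER `P_a ∩ {κ ≤ Re ≤ σ₀} ⊆ S` — [MW IV.1.11 (b)(d), proof IV.3.12]: in relative rank one the singularities in the closed positive chamber are finitely many, none on the unitary
axis, at real points (`π⊗λ = −w(π̄⊗λ̄)`), simple by (c); then `U := (⋃_a P_a ∖ S)ᶜ` is OPEN (a co-discrete set has only closed subsets, §1), contains the strip, and `s_{ab}` is holomorphic
on `U ∖ S` (§2 `entry_hs_of_exports`);
(ii) PER-COORDINATE SIMPLE-POLE DATA at each `c ∈ S` (★ `K2E1ChiPoleDataAtThreeHalvesOfScalarRoadCMThree` currency: `(z − c)·qc_j → ρ_j(c)`; a coordinate holomorphic at `c` has datum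
`0`): then `(z − c)·s_{ab}(z) → Σ_j ρ_j^{(a)}(c)·G_{abj}` (§3 `entry_hr_of_poleData`), and on a FINITE-DIMENSIONAL `V` entrywise limits of `(z − c)·⟪u, M(z)v⟫` — automatically sesquilinear
— are the matrix coefficients of ONE operator `R_c : V →ₗ[ℂ] V` (§4 `exists_residueOperator_of_tendsto_inner`, orthonormal-basis Riesz packaging), the `R` of ★ PB-2a′ and of ★ PB-2b∕2c's
positivity letter `hR`;
(iii) PER-COORDINATE BOX BOUNDS `‖qc_j(z)‖ ≤ B_q` on `{κ < Re ≤ σ₀, |Im| ≥ 1}` (the matrix Maass–Selberg inequality on the strip — MS road, L; scalar shape ★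
`K2E1ScatteringBoundMaassSelbergU2.exists_norm_le_of_maassSelberg_ineq (ρ₀ := 1)`): then `‖s_{ab}(z)‖ ≤ B` uniformly in `(a, b)` (§5 `entry_hB_of_boxBounds`).
* §1 `isClosed_of_subset_codiscrete`, `codiscrete_iUnion`.  * §2 **`entry_hs_of_exports`**.  * §3 `tendsto_sub_mul_of_poleDatum`, **`entry_hr_of_poleData`** (no-pole datum `0`: ★ `K2LiuEisensteinResidueRegularGenerators.tendsto_sub_mul_zero_of_continuousAt`).
* §4 `tendsto_sub_mul_inner_sum_smul`, **`exists_residueOperator_of_tendsto_inner`**.  * §5 **`entry_hB_of_boxBounds`**.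
HONEST LABEL: HC_CM is proved only modulo the 7 printed citations (2 remaining named inputs: hLiu418 = `stmt-HodgeConjecture-24832`, h413 = `stmt-HodgeConjecture-24833`) until rung 0
closes; this file asserts no named fact, closes no socket; count-neutral; the pole ledger, the per-coordinate pole data (★ at `3∕2` on the scalar road; a letter at the top pole `2`) and the
box bounds (MS road, L) are HYPOTHESES here, named so that nobody books them as paid.

## References
* [MoeglinWaldspurger1995] C. Mœglin, J.-L. Waldspurger, *Spectral decomposition and Eisenstein series* (1995), IV.1.8–IV.1.11; IV.3.12 (proof of IV.1.11), pp. 161–162.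
* [BernsteinLapid2019] J. Bernstein, E. Lapid, *On the meromorphic continuation of Eisenstein series*, J. Amer. Math. Soc. 37 (2024), Thm 2.3.
* [Langlands1976] R. P. Langlands, *On the Functional Equations Satisfied by Eisenstein Series*, LNM 544 (1976), §7.
-/

set_option autoImplicit false
set_option linter.dupNamespace false  -- the mandated namespace repeats the summit's segment (`HodgeConjecture.HodgeConjecture`)

noncomputable section

open Set Filter Topology Complex
open scoped ComplexConjugate InnerProductSpace BigOperators

namespace Summit.HodgeConjecture.HodgeConjecture.Cruxes.H413.K2E1PseudoEisensteinEntryLettersOfExports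

/-! ## §1 Co-discrete sets: every subset is closed; finite unions -/

/-- **A SUBSET OF A CO-DISCRETE SET IS CLOSED**: if every point of `ℂ` has a punctured neighbourhood missing `P` (the exports' clause `∀ z₀, ∀ᶠ s in 𝓝[≠] z₀, s ∉ P`), then every `T ⊆ P` is
closed (a point frequently approached by `T` is eventually not approached by `T ∖ {x}`, hence lies in `T`). [folklore] -/
theorem isClosed_of_subset_codiscrete {P T : Set ℂ} (hPd : ∀ z₀ : ℂ, ∀ᶠ s in 𝓝[≠] z₀, s ∉ P) (hT : T ⊆ P) : IsClosed T := by
  refine isClosed_iff_frequently.2 fun x hx => ?_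
  by_contra hxT
  have h1 : ∀ᶠ s in 𝓝 x, s ≠ x → s ∉ T := (eventually_nhdsWithin_iff.1 (hPd x)).mono fun s hs hsx hsT => hs hsx (hT hsT)
  have h2 : ∀ᶠ s in 𝓝 x, s ∉ T := h1.mono fun s hs hsT => by
    by_cases hsx : s = x
    · exact hxT (hsx ▸ hsT)
    · exact hs hsx hsT
  exact hx.and_eventually h2 |>.exists.elim fun s hs => hs.2 hs.1

/-- A FINITE UNION OF CO-DISCRETE SETS IS CO-DISCRETE. [folklore] -/
theorem codiscrete_iUnion {α : Type*} [Finite α] {P : α → Set ℂ} (hPd : ∀ a, ∀ z₀ : ℂ, ∀ᶠ s in 𝓝[≠] z₀, s ∉ P a) (z₀ : ℂ) :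
    ∀ᶠ s in 𝓝[≠] z₀, s ∉ ⋃ a, P a := by
  filter_upwards [eventually_all.2 fun a => hPd a z₀] with s hs
  simpa only [mem_iUnion, not_exists] using hs

/-! ## §2 `hs`: holomorphy of export-shaped entries on one open neighbourhood of the strip off the ledger's poles -/

/-- **`hs` OF ★ PB-2a′ FROM THE EXPORTS AND THE POLE LEDGER.**  Data: finitely many sections `a ∈ α`, each with continued coordinates `qc_j^{(a)}` holomorphic off a co-discrete pole set
`P_a` (★ exports: `∀ z₀, ∀ᶠ s in 𝓝[≠] z₀, s ∉ P_a` and `DifferentiableOn ℂ (qc_j^{(a)}) P_aᶜ`), constant Gram entries `G_{abj}`, and the POLE LEDGER in the closed strip **(hPℓ)**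
`P_a ∩ {κ ≤ Re z ≤ σ₀} ⊆ S` (`S` a finset of reals; [MW IV.1.11 (b)(d)]).  THEN with `U := (⋃_a P_a ∖ S)ᶜ`: `U` is open, contains `{κ ≤ Re z ≤ σ₀}`, and every entry
`z ↦ Σ_j qc_j^{(a)}(z)·G_{abj}` is holomorphic on `U ∖ S` — the `hUo`, `hUs`, `hs` bytes of ★ `pseudoEisenstein_contourShift_vector_axis_of_letters` ∕ `…_cm_three`.
[cite: MoeglinWaldspurger1995, IV.1.11] [cite: BernsteinLapid2019, Thm 2.3] -/
theorem entry_hs_of_exports {α β ι : Type*} [Finite α] [Fintype ι] (qc : α → ι → ℂ → ℂ) (G : α → β → ι → ℂ) (P : α → Set ℂ)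
    (hPd : ∀ a, ∀ z₀ : ℂ, ∀ᶠ s in 𝓝[≠] z₀, s ∉ P a) (hhol : ∀ a j, DifferentiableOn ℂ (qc a j) (P a)ᶜ)
    {κ σ₀ : ℝ} (S : Finset ℝ) (hPℓ : ∀ a, ∀ z ∈ P a, κ ≤ z.re → z.re ≤ σ₀ → z ∈ ((S.image fun c : ℝ => (c : ℂ)) : Set ℂ)) :
    ∃ U : Set ℂ, IsOpen U ∧ {z : ℂ | κ ≤ z.re ∧ z.re ≤ σ₀} ⊆ U ∧
      ∀ a b, DifferentiableOn ℂ (fun z : ℂ => ∑ j, qc a j z * G a b j) (U \ ((S.image fun c : ℝ => (c : ℂ)) : Set ℂ)) := by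
  refine ⟨(⋃ a, (P a \ ((S.image fun c : ℝ => (c : ℂ)) : Set ℂ)))ᶜ, ?_, ?_, ?_⟩
  · rw [isOpen_compl_iff]
    exact isClosed_of_subset_codiscrete (codiscrete_iUnion hPd) (iUnion_mono fun a => sdiff_subset)
  · intro z hz hzU
    obtain ⟨a, hza⟩ := mem_iUnion.1 hzU
    exact hza.2 (hPℓ a z hza.1 hz.1 hz.2)
  · intro a b
    have hsub : (⋃ a, (P a \ ((S.image fun c : ℝ => (c : ℂ)) : Set ℂ)))ᶜ \ ((S.image fun c : ℝ => (c : ℂ)) : Set ℂ) ⊆ (P a)ᶜ := by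
      intro z hz hzP
      exact hz.1 (mem_iUnion.2 ⟨a, hzP, hz.2⟩)
    exact DifferentiableOn.fun_sum fun j _ => ((hhol a j).mono hsub).mul_const _

/-! ## §3 `hr`: residues of export-shaped entries from per-coordinate pole data -/

/-- **A SIMPLE-POLE DATUM GIVES THE RESIDUE LIMIT**: if `d` is continuous at `c` and `d = (z − c)·q` on a punctured neighbourhood of `c` (★ `K2E1ChiPoleDataAtThreeHalvesOfScalarRoadCMThree`'s
currency, with `d` analytic at `c`), then `(z − c)·q(z) → d(c)`. [folklore] -/
theorem tendsto_sub_mul_of_poleDatum {q d : ℂ → ℂ} {c : ℂ} (hd : ContinuousAt d c) (hdq : ∀ᶠ z in 𝓝[≠] c, d z = (z - c) * q z) :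
    Tendsto (fun z : ℂ => (z - c) * q z) (𝓝[≠] c) (𝓝 (d c)) :=
  (hd.tendsto.mono_left nhdsWithin_le_nhds).congr' hdq

/-- **`hr` OF ★ PB-2a′ (ENTRYWISE) FROM PER-COORDINATE POLE DATA**: if at `c ∈ S` every continued coordinate has a simple-pole datum `(z − c)·qc_j^{(a)}(z) → ρ_j^{(a)}(c)` (datum `0` at a
regular point: ★ `K2LiuEisensteinResidueRegularGenerators.tendsto_sub_mul_zero_of_continuousAt`, cited not restated), then `(z − c)·Σ_j qc_j^{(a)}(z)·G_{abj} → Σ_j ρ_j^{(a)}(c)·G_{abj}`. [cite: MoeglinWaldspurger1995, IV.1.11] -/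
theorem entry_hr_of_poleData {α β ι : Type*} [Fintype ι] (qc : α → ι → ℂ → ℂ) (G : α → β → ι → ℂ) (S : Finset ℝ) (ρ : α → ι → ℝ → ℂ)
    (hρ : ∀ a j, ∀ c ∈ S, Tendsto (fun z : ℂ => (z - c) * qc a j z) (𝓝[≠] (c : ℂ)) (𝓝 (ρ a j c))) (a : α) (b : β) {c : ℝ} (hc : c ∈ S) :
    Tendsto (fun z : ℂ => (z - c) * ∑ j, qc a j z * G a b j) (𝓝[≠] (c : ℂ)) (𝓝 (∑ j, ρ a j c * G a b j)) := by
  have e : ∀ z : ℂ, (z - c) * ∑ j, qc a j z * G a b j = ∑ j, (z - c) * qc a j z * G a b j := fun z => by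
    rw [Finset.mul_sum]
    exact Finset.sum_congr rfl fun j _ => by ring
  simp_rw [e]
  exact tendsto_finsetSum _ fun j _ => (hρ a j c hc).mul_const _

/-! ## §4 Entrywise residues are the matrix coefficients of ONE residue operator (finite-dimensional Riesz packaging) -/

section Residue

variable {V : Type*} [NormedAddCommGroup V] [InnerProductSpace ℂ V]

/-- Limits of the sesquilinear family `(u, v) ↦ (z − c)·⟪u, M(z)v⟫` are conjugate-linear in `u` along finite sums: `r(Σ_i a_i•e_i, v) = Σ_i conj a_i · r(e_i, v)` (uniqueness of limits in
the punctured filter). [folklore] -/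
theorem tendsto_sub_mul_inner_sum_smul {ι : Type*} [Fintype ι] (M : ℂ → V →ₗ[ℂ] V) (c : ℂ) {r : V → V → ℂ}
    (hr : ∀ u v, Tendsto (fun z : ℂ => (z - c) * ⟪u, M z v⟫_ℂ) (𝓝[≠] c) (𝓝 (r u v))) (a : ι → ℂ) (e : ι → V) (v : V) :
    r (∑ i, a i • e i) v = ∑ i, conj (a i) * r (e i) v := by
  have h1 := hr (∑ i, a i • e i) v
  have h2 : Tendsto (fun z : ℂ => (z - c) * ⟪∑ i, a i • e i, M z v⟫_ℂ) (𝓝[≠] c) (𝓝 (∑ i, conj (a i) * r (e i) v)) := by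
    have h3 : Tendsto (fun z : ℂ => ∑ i, conj (a i) * ((z - c) * ⟪e i, M z v⟫_ℂ)) (𝓝[≠] c) (𝓝 (∑ i, conj (a i) * r (e i) v)) :=
      tendsto_finsetSum _ fun i _ => (hr (e i) v).const_mul _
    refine h3.congr fun z => ?_
    rw [sum_inner, Finset.mul_sum]
    exact Finset.sum_congr rfl fun i _ => by rw [inner_smul_left]; ring
  exact tendsto_nhds_unique h1 h2

/-- **THE RESIDUE OPERATOR**: on a finite-dimensional complex inner-product space, if every matrix coefficient `(z − c)·⟪u, M(z)v⟫` has a limit `r(u, v)` as `z → c`, `z ≠ c`, then there is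
ONE `R : V →ₗ[ℂ] V` with `(z − c)·⟪u, M(z)v⟫ → ⟪u, R v⟫` for all `u, v` (`R v := Σ_i r(e_i, v)•e_i` in an orthonormal basis; `r` is sesquilinear by uniqueness of limits) — the residue
operator `R_c` of ★ PB-2a′'s `hr` and of ★ PB-2b∕2c's positivity letter `hR`. [cite: MoeglinWaldspurger1995, IV.1.11] [cite: Langlands1976, §7] -/
theorem exists_residueOperator_of_tendsto_inner [FiniteDimensional ℂ V] (M : ℂ → V →ₗ[ℂ] V) (c : ℂ) {r : V → V → ℂ}
    (hr : ∀ u v, Tendsto (fun z : ℂ => (z - c) * ⟪u, M z v⟫_ℂ) (𝓝[≠] c) (𝓝 (r u v))) :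
    ∃ R : V →ₗ[ℂ] V, ∀ u v, Tendsto (fun z : ℂ => (z - c) * ⟪u, M z v⟫_ℂ) (𝓝[≠] c) (𝓝 ⟪u, R v⟫_ℂ) := by
  set e := stdOrthonormalBasis ℂ V with he
  -- `r` is additive and homogeneous in the second variable (uniqueness of limits)
  have hadd : ∀ u v w, r u (v + w) = r u v + r u w := fun u v w => by
    refine tendsto_nhds_unique (hr u (v + w)) ?_
    refine ((hr u v).add (hr u w)).congr fun z => ?_
    rw [map_add, inner_add_right, mul_add]
  have hsmul : ∀ u (x : ℂ) v, r u (x • v) = x * r u v := fun u x v => by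
    refine tendsto_nhds_unique (hr u (x • v)) ?_
    refine ((hr u v).const_mul x).congr fun z => ?_
    rw [map_smul, inner_smul_right]; ring
  refine ⟨{ toFun := fun v => ∑ i, r (e i) v • e i
            map_add' := fun v w => by simp only [hadd, add_smul, Finset.sum_add_distrib]
            map_smul' := fun x v => by simp only [hsmul, RingHom.id_apply, Finset.smul_sum, smul_smul] }, fun u v => ?_⟩
  -- `⟪u, R v⟫ = r u v`: expand `u` in the orthonormal basis and use conjugate-linearity of `r` in `u`
  have hbasis : ∀ k, ⟪e k, ∑ i, r (e i) v • e i⟫_ℂ = r (e k) v := fun k => e.orthonormal.inner_right_fintype _ k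
  have hu : u = ∑ i, ⟪e i, u⟫_ℂ • e i := by
    conv_lhs => rw [← e.sum_repr u]
    simp only [OrthonormalBasis.repr_apply_apply]
  have key : ⟪u, ∑ i, r (e i) v • e i⟫_ℂ = r u v := by
    rw [hu, sum_inner, tendsto_sub_mul_inner_sum_smul M c hr]
    exact Finset.sum_congr rfl fun i _ => by rw [inner_smul_left, hbasis i]
  change Tendsto (fun z : ℂ => (z - c) * ⟪u, M z v⟫_ℂ) (𝓝[≠] c) (𝓝 ⟪u, ∑ i, r (e i) v • e i⟫_ℂ)
  rw [key]
  exact hr u v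

end Residue

/-! ## §5 `hB`: the strip bound of export-shaped entries from per-coordinate box bounds -/

/-- **`hB` OF ★ PB-2a′ FROM PER-COORDINATE BOX BOUNDS**: if `‖qc_j^{(a)}(z)‖ ≤ B_q` on `{κ < Re z ≤ σ₀, |Im z| ≥ 1}` for all `a, j` (the matrix Maass–Selberg box bound on the strip —
MS road; scalar shape ★ `K2E1ScatteringBoundMaassSelbergU2.exists_norm_le_of_maassSelberg_ineq`), then ONE constant `B` bounds every entry `Σ_j qc_j^{(a)}(z)·G_{abj}` there (finitely
many `(a, b)`). [cite: MoeglinWaldspurger1995, IV.1.11] [cite: Langlands1976, §7] -/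
theorem entry_hB_of_boxBounds {α β ι : Type*} [Fintype α] [Fintype β] [Fintype ι] (qc : α → ι → ℂ → ℂ) (G : α → β → ι → ℂ) {κ σ₀ Bq : ℝ}
    (hbox : ∀ a j, ∀ z : ℂ, κ < z.re → z.re ≤ σ₀ → 1 ≤ |z.im| → ‖qc a j z‖ ≤ Bq) :
    ∃ B : ℝ, ∀ a b, ∀ z : ℂ, κ < z.re → z.re ≤ σ₀ → 1 ≤ |z.im| → ‖∑ j, qc a j z * G a b j‖ ≤ B := by
  refine ⟨max Bq 0 * ∑ a, ∑ b, ∑ j, ‖G a b j‖, fun a b z h1 h2 h3 => ?_⟩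
  have hab : ∑ j, ‖G a b j‖ ≤ ∑ a, ∑ b, ∑ j, ‖G a b j‖ := by
    have h₁ : ∑ j, ‖G a b j‖ ≤ ∑ b', ∑ j, ‖G a b' j‖ :=
      Finset.single_le_sum (f := fun b' => ∑ j, ‖G a b' j‖) (fun b' _ => Finset.sum_nonneg fun j _ => norm_nonneg _) (Finset.mem_univ b)
    have h₂ : ∑ b', ∑ j, ‖G a b' j‖ ≤ ∑ a', ∑ b', ∑ j, ‖G a' b' j‖ :=
      Finset.single_le_sum (f := fun a' => ∑ b', ∑ j, ‖G a' b' j‖) (fun a' _ => Finset.sum_nonneg fun b' _ => Finset.sum_nonneg fun j _ => norm_nonneg _) (Finset.mem_univ a)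
    exact h₁.trans h₂
  calc ‖∑ j, qc a j z * G a b j‖ ≤ ∑ j, ‖qc a j z * G a b j‖ := norm_sum_le _ _
    _ ≤ ∑ j, max Bq 0 * ‖G a b j‖ := Finset.sum_le_sum fun j _ => by
        rw [norm_mul]
        exact mul_le_mul_of_nonneg_right ((hbox a j z h1 h2 h3).trans (le_max_left _ _)) (norm_nonneg _)
    _ = max Bq 0 * ∑ j, ‖G a b j‖ := by rw [Finset.mul_sum]
    _ ≤ max Bq 0 * ∑ a, ∑ b, ∑ j, ‖G a b j‖ := mul_le_mul_of_nonneg_left hab (le_max_right _ _)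

end Summit.HodgeConjecture.HodgeConjecture.Cruxes.H413.K2E1PseudoEisensteinEntryLettersOfExports

end
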